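import Mathlib
import HarnessLib
import HarnessLib.Audit
import Summits.CriticalPhenomena.Statement
import Literature.Probability.LatticeModels.ScalingLimit3D
import HarnessLib.Audit.Status.Attr

/-!
Route: CoerciveSharpness

DORMANT since 2026-08-26T09:04:16Z (reconciler: no traction for 8.4 d (last activity item-evidence-added at 2026-08-17T23:05:48Z); parked, not closed — `ledger route dormant route-CriticalPhenomena-CoerciveSharpness --off` to reactivate) — unstaffed, not closed; items shared with open routes are served there. `ledger route dormant <id> --off` reactivates.

# Route CoerciveSharpness — sharpness has a second gear — coercivity of φ_β(S) at β_c(3) gives η <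
1/2 and a non-Gaussian limit

It suffices to show X = K1 ∧ K2a ∧ K2b ∧ E ∧ C ∧ M, realising card
coercive-sharpness-boundary-amplification (spine; its K1/K2) with the
closure of card top-heavy-bubble-nontriviality taken as the SHARED item WindowForcesU4 (stmt-5505).
K1 = PhiCoercive: the
Duminil-Copin–Tassion/Panis sharpness functional φ_β(S) = β Σ_(x∈S, y∉S, y∼x) ⟨σ₀σ_x⟩^free_S — so
far only compared with the constant 1 —
is COERCIVE at β_c(3): φ_(β_c)(S) ≥ c m^κ for every finite S ⊇ Λ_m, some κ > 0 (surface scaling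
predicts κ_box = d−1−Δ_σ−Δ̂_σ = 1 − η_⊥ ≈
0.21 on ℤ³, 3/8 exactly on ℤ², and κ = 0 EXACTLY in mean field, where the boundary flux of ⟨σ₀σ_·⟩
is conserved harmonic measure).
K2a = CoerciveReflectedGradient: coercivity fed into the tree's PROVED Duminil-Copin–Panis Theorem
1.2 (reflected currents) makes the
reflected gradient Q(n) grow like n^κ'. K2b = WindowOfGrowth: a growing Q(n) plus two-sided η-bounds
(E = DimensionPinned, stmt-4662)
give the window η_eff < 1/2 between all scales (Δ_σ < 3/4 strictly — the "n^ε beyond DC–Panis" that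
every second-moment card names as its
missing input). C = WindowForcesU4 (stmt-5505): the window forces U₄ ≢ 0 in every non-degenerate
pointwise scaling limit (second moment on
two independent sourced currents). M = MoebiusLimit (stmt-1344): the conjunct minus clause (iii),
imported. Rotation invariance of limits is
now a theorem of the tree (stmt-1980) and is not touched; this route is a clause-(iii) route whose
own content is K1.
Lean: `PhiCoercive ∧ CoerciveReflectedGradient ∧ WindowOfGrowth ∧ DimensionPinned ∧ WindowForcesU4 ∧
MoebiusLimit`

## Assembly
Pure logic (sorry-free in the planner's Sketch.lean and glue.lean, `closes`, axioms
propext/Classical.choice/Quot.sound): take (ρ, Δ, S)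
with ρ > 0, Δ > 0, the pointwise limit, non-degeneracy and Möbius covariance from MoebiusLimit;
WindowOfGrowth applied to
(CoerciveReflectedGradient PhiCoercive) and DimensionPinned gives the window; WindowForcesU4 applied
to the window and (ρ, S) gives
HasNontrivialU4 S; the tuple is Literature.Probability.LatticeModels.CritIsing3DConformalLimit =
Ising3DConformalLimit. Every hypothesis is used.

Rationale: WHY THIS LINE. Mechanism: read the sharpness functional φ_β(S) of DuminilcopinTassion2016
(arXiv:1502.03050) AT β_c as a function of the SHAPE of S; its
growth exponent is a BOUNDARY critical exponent (ordinary transition: Δ̂_σ ≈ 1.276, Hasenbusch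
arXiv:1012.4986, Gliozzi et al.
arXiv:1502.07217, Diehl arXiv:cond-mat/9610143), positive exactly when the interacting bulk heals
from a free wall faster than a harmonic
function — an interaction- and dimension-sensitive statement, as any input to clause (iii) must be
(IsingTrivialityFromDimensionFour). The
single place where DuminilCopinPanis2025LowerBounds (arXiv:2404.05700 §2.2, eq. (2.5)) use φ ≥ 1/2
is an abstract hypothesis of the tree's
PROVED `DCPLower.pointwise_master_weight` / `infiniteVolume_ineq_of_lemma25`; replacing the base
point 0 by the base box Λ_m (union bound
from the infrared bound, m ≍ n^(1/3)) turns c₀ into c m^κ and Theorem 1.5 (η ≤ 1/2,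
`dcp_isingEta_le_half_holds`) into η ≤ 1/2 − κ'/2.
Imported area: boundary critical phenomena / surface exponents, never used by the 51 open routes
(whose clause-(iii) levers are bulk:
energy sector, Lee–Yang, pinning, entropy, SDP, Ptolemy). Negatives index: nothing on this
sub-problem.

RANKED CRUXES. #2 PhiCoercive (crux) — COERCIVITY of the sharpness functional at β_c(3): there are
κ, c > 0 with φ_(β_c)(S) ≥ c·m^κ for every m ≥ 1 and every finite S ⊆ ℤ³ containing the box Λ_m
(card K1; φ_β(S) = β Σ_(x∈S) #{y ∉ S : y ∼ x}·⟨σ₀σ_x⟩^free_(S,β) written out over isingTwoPoint /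
zdGraph 3 — literally the definiens of the tree's dcpPhi (Duminil-Copin–Panis Def. 1.1), Iff.rfl to
rev 0). [difficulty: open-problem] (why it might fail: every printed lower bound on critical
correlations (Simon, φ_(β_c) ≥ 1, DC–Panis) is saturated in mean field; κ_box > 0 rests on Δ_σ+Δ̂_σ
≈ 1.79 < 2 (numerics/bootstrap/ε-expansion); an adversarial superset S ⊋ Λ_m might depress φ below
c·φ(Λ_m).) [arXiv:1502.03050, arXiv:2404.05700, arXiv:1012.4986, arXiv:1502.07217,
arXiv:cond-mat/9610143]
#3 CoerciveReflectedGradient (crux) — coercivity upgrades Duminil-Copin–Panis Theorem 1.2 at β_c(3):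
PhiCoercive ⇒ the reflected gradient Q(n) = Σ_(x,y∈Λ_n, y∼x) (⟨σ₀σ_x⟩ − ⟨σ₀σ_(R_n x)⟩)⟨σ_yσ_(R_n y)⟩
is ≥ c₀ n^κ' for large n, some κ' > 0 (R_n x = Function.update x 0 (2n − x₀), = dcpReflect 0 n x by
rfl; at κ' = 0 this is the tree's dcp_reflectedGradient_lower, proved). [deps: PhiCoercive]
[difficulty: M] (why it might fail: clerical only — the coercive input must hold on the random set
𝒮_n ⊇ Λ_m of §2.2 (it does: PhiCoercive quantifies over all finite supersets) and the union bound
needs (2m+1)³ ≲ n (infrared bound); the tree's master inequality is base-point-0 and must be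
generalised to a base box.) [arXiv:2404.05700,
Literature.Probability.LatticeModels.dcp_reflectedGradient_lower]
#4 WindowOfGrowth (crux) — a reflected gradient growing like n^κ' plus two-sided power bounds with
one exponent η force η ≤ 1/2 − κ'/2 < 1/2 (Theorem 1.3/1.5 of DC–Panis rerun with the extra n^κ'),
hence the WINDOW c(n/m)^(−(3/2−ε)) G(m e₁) ≤ G(n e₁) for all 1 ≤ m ≤ n (ε = 1/2 − η; conclusion =
item stmt-5507 WindowBelowHalf of LatticeSDPCertificates verbatim). [deps:
CoerciveReflectedGradient] [difficulty: M] (why it might fail: provable now in substance (adapt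
dcp_isingEta_le_half_of_axis_lower and axis_lower_of_reflectedGradient; rpow bookkeeping); fails
only if the two-sided bounds are dropped — a log-sense η does not give the uniform window between
close scales.) [arXiv:2404.05700, Literature.Probability.LatticeModels.dcp_isingEta_le_half,
arXiv:1912.07973]
#5 WindowForcesU4 (crux) — SHARED item stmt-CriticalPhenomena-5505 (LatticeSDPCertificates r3),
verbatim: the window η_eff < 1/2 forces U₄ ≢ 0 in every non-degenerate pointwise scaling limit of
criticalCorr 3 (Aizenman's second moment on two independent sourced currents; top-heavy bubble from
the window, windowGivesTopHeavyBubble_proof landed). [difficulty: XL] (why it might fail: single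
sourced current clusters may be thinner than double-current clusters (the second moment needs a
two-point bound on P[u,v ∈ C] of chain type, ADC21 Prop. A.3 shape); the window controls G only
along the axis (MMS extends it).) [Aizenman1982, arXiv:1912.07973, arXiv:2404.05700]
#6 DimensionPinned (crux) — SHARED item stmt-CriticalPhenomena-4662 (ClusterRigidity), verbatim:
two-sided pure-power bounds c‖x‖^(−(1+η)) ≤ ⟨σ₀σ_x⟩_(β_c(3)) ≤ C‖x‖^(−(1+η)) for some η
(HasIsingEtaBounds 3 η) — the regularity currency in which a strict exponent inequality becomes an
all-scale window. [difficulty: open-problem] (why it might fail: existence of η in this strong form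
is open on ℤ³ (ICM 2022 §8.4); only c‖x‖⁻² ≤ G ≤ C‖x‖⁻¹ is known, and a slowly varying correction
would falsify the two-sided form while keeping a log-sense η.) [DuminilCopinICM2022,
arXiv:1912.07973, arXiv:2404.05700]
#7 MoebiusLimit (crux) — SHARED item stmt-CriticalPhenomena-1344, verbatim (imported complement,
lowest rank): the critical correlators on ℤ³ have a non-degenerate Möbius-covariant pointwise
scaling limit — the conjunct minus clause (iii); this route attacks clause (iii) only. [difficulty:
open-problem] (why it might fail: existence (stmt-1981) and inversion covariance (stmt-1982) are
open on ℤ³; ScaleCovarianceNotMoebius shows Euclidean + scale data never force inversion.)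
[DuminilCopinICM2022, PolandRychkovVichi2019,
Literature.Barriers.CriticalPhenomena.ScaleCovarianceNotMoebius]

TWO-LAYER PLAN. Foreseen glued splits (nothing filed now): PhiCoercive ⇐ BoxCoercive (φ_(β_c)(Λ_m) ≥
c m^κ: the surface-exponent half) → SupersetStable
(∀ S ⊇ Λ_m, φ(S) ≥ c′φ(Λ_m): GKS surgery) → PhiCoercive (the birth skeleton
bc/PhiCoercive_birth.lean already has this shape, composition
proved); BoxCoercive ⇐ HalfSpaceResponse (R(n) = Σ_(x∈∂ℍ) ⟨σ_(ne₁)σ_x⟩^free_ℍ ≥ c n^κ) →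
BoxFromHalfSpace. CoerciveReflectedGradient ⇐
CoerciveMasterIntegrated → UnionBound → ScaleSelection (skeleton
bc/CoerciveReflectedGradient_birth.lean, 4 stubs). WindowOfGrowth ⇐
CoerciveAxisLower → EtaStrict → WindowOfEtaLtHalf (skeleton bc/WindowOfGrowth_birth.lean, 3 stubs);
its conclusion is stmt-5507 verbatim.

KILL CRITERIA. PhiCoercive refuted (a bounded φ_(β_c)(Λ_n) on ℤ³, or an explicit superset family
with φ(S_m)/m^κ → 0 for every κ > 0) closes the route
`refuted:PhiCoercive` and is a Barriers candidate ("sharpness is not coercive"). A 2D exact check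
φ_(β_c(2))(Λ_n) ≁ n^(3/8) kills the dictionary
φ-growth = 1 − η_⊥ and forces a pivot to the half-space response R(n). WindowForcesU4 refuted kills
every second-moment card at once (pivot:
η > 0 via AnomalousForcesInteraction). DimensionPinned refuted-substantive (slowly varying
corrections) ⇒ restate K2b over all-scale doubling.
Proved elsewhere: stmt-0636 (U₄ for every non-degenerate limit) moots C and K2b;
EnergyNotSigmaSquared / SubPtolemyInterlacing closing (iii) moots the route.

NOT DECOMPOSED YET. The milestone GrowingReflectedGradient (∃κ′ c₀ N₀, c₀ n^κ′ ≤ Q(n)) is inlined in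
K2a/K2b rather than filed (decl-order constraint); the
half-space avatar R(n), the image sandwich ⟨σ_zσ_x⟩ − ⟨σ_zσ_(Rx)⟩ ≤ ⟨σ_zσ_x⟩^free_ℍ, the
tentacle-forest surgery and the constants (2m+1)³ ≲ n
are layer-2 children; the φ⁴/Griffiths–Simon extension of DC–Panis is not needed (Ising only).

CHEAPEST FALSIFIER. (i) In-Lean, DONE: at κ = 0 the crux is a theorem (bc/PhiCoercive_birth.lean
`special_kappa_zero`: φ_(β_c)(S) ≥ 1/2 for every bounded S ⊇ Λ_m,
from sharpLength_criticalBeta_eq_top + half_le_dcpPhi_of_subset_box) — so only GROWTH is at stake;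
(ii) exact 2D transfer matrices:
φ_(β_c(2))(Λ_n), n ≤ 7, must grow with local exponent → 3/8 (seconds; the card's job j002376,
results not readable from this seat); (iii)
Swendsen–Wang at β_c(3) = 0.2216546 on free cubes n ≤ 24: φ(Λ_n) ∝ n^0.21 predicted, d = 5 control
flat; adversarial shapes (3D cross,
hedgehog) must not beat boxes by more than a constant.

NUMBERS. β_c(3) = 0.221654626(5); Δ_σ = 0.5181489(10) (KosPolandSimmonsDuffinVichi2016); boundary
(ordinary) Δ̂_σ = 1.2751(6) ⇔ y_h1 = 0.7249(6)
(arXiv:1012.4986), bootstrap Δ̂ ≈ 1.276 (arXiv:1502.07217); κ_box = 2 − Δ_σ − Δ̂_σ ≈ 0.206 (ℤ³), =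
3/8 (ℤ², Δ̂ = 1/2, McCoy–Wu ch. VII), = 0
(GFF/mean field, d ≥ 5); target η ≤ 1/2 − κ′/2 with κ′ = κ/3 from m ≍ n^(1/3); truth η =
0.036298(2). Items at open: 7 (6 cruxes + assembly).

DEFINITION REQUESTS. None. CONE (rev 1, route repair 2026-08-17): the route file now imports NOTHING
outside the sub-problem Statement cone — dcpPhi (SharpLengthDCP.lean) and dcpReflect
(CriticalTwoPointDCPLower.lean) are written out by their definientia inside PhiCoercive /
CoerciveReflectedGradient / WindowOfGrowth, each restated item being Iff.rfl-equal to its rev-0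
predecessor (planner Bridge.lean, lean rc 0), so the two DCP modules (four named facts
dcp_nearCritical_upper, dcp_twoPoint_axis_lower_nearCritical, dcp_reflectedGradient_lower,
dcp_criticalTwoPoint_axis_lower — all discharged, `_holds` in SharpLengthDCPProofs /
SharpLengthDCPTorus / CriticalTwoPointDCPLowerHolds) and the gate-only module HarnessLib.Audit.Check
no longer ride in the module cone; box, Site, zdGraph, isingTwoPoint, twoPointFree, freeExpect,
spinPair, criticalBeta, criticalTwoPoint, HasIsingEtaBounds, CorrFamily, HasPointwiseScalingLimit,
criticalCorr, IsNondegenerateTwoPoint, HasNontrivialU4, IsMoebiusCovariant are all in the Statement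
cone (lean search --decl). No named fact is a hypothesis of any item — needs-fact: none. PROVERS:
`show`/`change` converts a goal to the dcpPhi / dcpReflect API by rfl (e.g. `show _ ≤
Literature.Probability.LatticeModels.dcpPhi 3 _ S`); a Theorems file may import SharpLengthDCP /
CriticalTwoPointDCPLower (their four facts are discharged elsewhere) but should check, before
importing any further Literature module (the …Holds / …Proofs / …Torus companions included), that
its import cone holds no unproved named fact — the gate links proved items into the route file and
the cone guardrail would block the route again.

Novelty: Searches (2026-08-17): all 54 Theses headers + 131 idea cards of the sub read (0 routes use φ_β(S),
boundary exponents or the free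
surface; `grep dcpPhi` over Theses: 0); `lit frontier CriticalPhenomena --since 2024` (30 rows;
DC–Panis CMP 2025 held and re-read pp. 5–6,
9–10; nothing on growth of φ at β_c); `lit galaxy search "scale invariance vs conformal invariance"
--star all` (4 rows, none relevant);
`lit vsearch` on scale⇒conformal (books only); `lit search` local daemon down (ConnectionReset ×4),
OpenAlex/arXiv 429 — critic please re-run
S2 for "sharpness functional growth critical" / "boundary magnetisation lower bound Ising three
dimensions".
Nearest prior art found: arXiv:2404.05700 (DC–Panis 2025, Thm 1.2/1.3/1.5: φ used against the
constant 1/2 once; η ≤ 1/2 non-strict — fully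
proved in the tree); arXiv:1502.03050 (φ_β(S) defined, compared with 1); arXiv:1012.4986 /
arXiv:1502.07217 / arXiv:cond-mat/9610143
(the boundary exponent y_h1 − Δ_σ ≈ 0.21, non-rigorous); card
coercive-sharpness-boundary-amplification (mechanism critic: new-mechanism),
unrouted. Nearest routes: PerfectScreening (CoulombU4 = second moment at η = 0),
LatticeSDPCertificates (the window from SDP certificates),
EnergyNotSigmaSquared (ε-sector exponent gap).
Delta: the strict inequality η < 1/2 (hence U₄ ≢ 0) is sourced from a SURFACE critical exponent
through coercivity of the sharpness
functional, and the Duminil-Copin–Panis upgrade it needs is mechanical over theorems already landed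
in the tre  [refs: 2404.05700, 1502.03050, 1012.4986, 1502.07217, cond-mat/9610143]

Barriers (technique_class: random-currents, boundary-critical, sharpness-phi): - technique_class: random-currents, boundary-critical, sharpness-phi
- Literature.Barriers.CriticalPhenomena.IsingTrivialityFromDimensionFour: evaded by construction —
PhiCoercive is FALSE in mean field / d ≥ 5 (κ = 0: harmonic-measure conservation), so the line
cannot be a dimension-uniform argument; the escaping hypothesis is κ > 0 itself.
- Literature.Barriers.CriticalPhenomena.LongRangeTrivialityOnZ3: the trivial RP long-range models on
ℤ³ have mean-field boundary exponents, PhiCoercive fails for them — consistent, and the statement is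
about the nearest-neighbour model only.
- Literature.Barriers.CriticalPhenomena.BootstrapLatticeBlindness: every item is a statement about
free-boundary finite Ising systems on ℤ³ or the critical ℤ³ two-point function; bootstrap numbers
(Δ̂_σ) enter only as evidence for κ > 0, never as input.
- Literature.Barriers.CriticalPhenomena.RigorousRGSmallParameter: no expansion, no small parameter;
random currents + GKS + reflections.
- Literature.Barriers.CriticalPhenomena.PositionSpaceRGNonGibbsian: no map on Hamiltonians.
- Literature.Barriers.CriticalPhenomena.ScaleCovarianceNotMoebius: not engaged — clause (ii) and
existence are imported (MoebiusLimit); the route claims nothing about inversion.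
- Literature.Barriers.CriticalPhenomena.LiouvilleRigidity: not engaged (no conformal maps used).
- Negatives index: 11 refuted statements of the summit, none on Ising3DConformalLimit; nothing
restated.

History (route lifecycle, newest last):
- 2026-08-17T02:23:22Z · rev 1: restated PhiCoercive (stmt-CriticalPhenomena-17619), CoerciveReflectedGradient (stmt-CriticalPhenomena-17620), WindowOfGrowth (stmt-CriticalPhenomena-17621) — route-repair (cone): re-route around — imports SharpLengthDCP, CriticalTwoPointDCPLower, HarnessLib.Audit.Check dropped (dcpPhi / dcpReflect written out b (planner-rrepair-CriticalPhenomena-CoerciveShar-65dfe21b-0)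
- 2026-08-26T09:04:16Z · DORMANT — reconciler: no traction for 8.4 d (last activity item-evidence-added at 2026-08-17T23:05:48Z); parked, not closed — `ledger route dormant route-CriticalPhenomen (operator:999:2863985)

sub-problem: Ising3DConformalLimit · status: dormant · opened planner-plan-novel-CriticalPhenomena-Ising3DCon-3ad144fc-v2-g14-0 2026-08-17T02:04:05Z · rev 2 · ledger route-CriticalPhenomena-CoerciveSharpness
GENERATED by the gate from the ledger (D-0016/17). Provers cite these decls: `theorem foo : Summit.CriticalPhenomena.Ising3DConformalLimit.Theses.CoerciveSharpness.<Decl> := …` in Summits/CriticalPhenomena/Ising3DConformalLimit/Theorems/<Name>.lean.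
-/

namespace Summit.CriticalPhenomena.Ising3DConformalLimit.Theses.CoerciveSharpness

open scoped BigOperators Topology Manifold Classical MeasureTheory ProbabilityTheory Matrix InnerProductSpace ComplexConjugate ContinuousMap
open Filter Set Function TopologicalSpace MeasureTheory

attribute [summit_statement] _root_.Ising3DConformalLimit

-- earlier PhiCoercive (stmt-CriticalPhenomena-17619, replaced 2026-08-17T02:23:22Z -> stmt-CriticalPhenomena-18196): retired by None — ∃ κ c : ℝ, 0 < κ ∧ 0 < c ∧ ∀ m : ℕ, 1 ≤ m → ∀ S : Finset (Literature.Probability.LatticeModels.Site 3), Literature.Probability.LatticeModels.box 3 m ⊆ S → c * (m : ℝ) ^ κ ≤ Literature.Probability.LatticeModels.dcpPhi 3 (Literature.Probability.LatticeModels.criticalBe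
/-- item stmt-CriticalPhenomena-18196 · crux · rank 2 · open · by planner
why it might fail: every printed lower bound on critical correlations (Simon, φ_(β_c) ≥ 1, DC–Panis) is saturated in mean field; κ_box > 0 rests on Δ_σ+Δ̂_σ ≈ 1.79 < 2 (numerics/bootstrap/ε-expansion); an adversarial superset S ⊋ Λ_m might depress φ below c·φ(Λ_m).
sources: arXiv:1502.03050, arXiv:2404.05700, arXiv:1012.4986, arXiv:1502.07217, arXiv:cond-mat/9610143
[crux] COERCIVITY of the sharpness functional at β_c(3): there are κ, c > 0 with φ_(β_c)(S) ≥ c·m^κ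
for every m ≥ 1 and every finite S ⊆ ℤ³ containing the box Λ_m (card K1; φ_β(S) = β Σ_(x∈S) #{y ∉ S
: y ∼ x}·⟨σ₀σ_x⟩^free_(S,β), the definiens of the tree's dcpPhi written out over isingTwoPoint /
zdGraph so that the route imports only the Statement cone; Iff.rfl to rev 0). [difficulty:
open-problem] -/
@[route_item "route-CriticalPhenomena-CoerciveSharpness", crux]
def PhiCoercive : Prop :=
  ∃ κ c : ℝ, 0 < κ ∧ 0 < c ∧ ∀ m : ℕ, 1 ≤ m → ∀ S : Finset (Literature.Probability.LatticeModels.Site 3), Literature.Probability.LatticeModels.box 3 m ⊆ S → c * (m : ℝ) ^ κ ≤ Literature.Probability.LatticeModels.criticalBeta 3 * ∑ x ∈ S, ((((Literature.Probability.LatticeModels.zdGraph 3).neighborFinset x).filter fun y => y ∉ S).card : ℝ) * Literature.Probability.LatticeModels.isingTwoPoint (Literature.Probability.LatticeModels.zdGraph 3) S (Literature.Probability.LatticeModels.criticalBeta 3) 0 .free 0 x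

-- earlier CoerciveReflectedGradient (stmt-CriticalPhenomena-17620, replaced 2026-08-17T02:23:22Z -> stmt-CriticalPhenomena-18197): retired by None — PhiCoercive → (∃ κ' c₀ : ℝ, 0 < κ' ∧ 0 < c₀ ∧ ∃ N₀ : ℕ, ∀ n : ℕ, N₀ ≤ n → c₀ * (n : ℝ) ^ κ' ≤ ∑ x ∈ Literature.Probability.LatticeModels.box 3 n, ∑ i : Fin 3, ((if x + Pi.single i 1 ∈ Literature.Probability.LatticeModels.box 3 n then (Literature.Probabi
/-- item stmt-CriticalPhenomena-18197 · crux · rank 3 · closed · proved by Summit.CriticalPhenomena.Ising3DConformalLimit.Theorems.coerciveReflectedGradient_proof @ 484cbd02805f (prover) · by planner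
why it might fail: clerical only — the coercive input must hold on the random set 𝒮_n ⊇ Λ_m of §2.2 (it does: PhiCoercive quantifies over all finite supersets) and the union bound needs (2m+1)³ ≲ n (infrared bound); the tree's master inequality is base-point-0 and must be generalised to a base box.
sources: arXiv:2404.05700, Literature.Probability.LatticeModels.dcp_reflectedGradient_lower
[crux] coercivity upgrades Duminil-Copin–Panis Theorem 1.2 at β_c(3): PhiCoercive ⇒ the reflected
gradient Q(n) = Σ_(x,y∈Λ_n, y∼x) (⟨σ₀σ_x⟩ − ⟨σ₀σ_(R_n x)⟩)⟨σ_yσ_(R_n y)⟩ is ≥ c₀ n^κ' for large n,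
some κ' > 0 (R_n x = Function.update x 0 (2n − x₀) = dcpReflect 0 n x by rfl, written out so that
the route imports only the Statement cone; at κ' = 0 this is the tree's dcp_reflectedGradient_lower,
proved). [deps: PhiCoercive] [difficulty: M] -/
@[route_item "route-CriticalPhenomena-CoerciveSharpness", crux]
def CoerciveReflectedGradient : Prop :=
  PhiCoercive → (∃ κ' c₀ : ℝ, 0 < κ' ∧ 0 < c₀ ∧ ∃ N₀ : ℕ, ∀ n : ℕ, N₀ ≤ n → c₀ * (n : ℝ) ^ κ' ≤ ∑ x ∈ Literature.Probability.LatticeModels.box 3 n, ∑ i : Fin 3, ((if x + Pi.single i 1 ∈ Literature.Probability.LatticeModels.box 3 n then (Literature.Probability.LatticeModels.twoPointFree 3 (Literature.Probability.LatticeModels.criticalBeta 3) x - Literature.Probability.LatticeModels.twoPointFree 3 (Literature.Probability.LatticeModels.criticalBeta 3) (Function.update x (0 : Fin 3) (2 * (n : ℤ) - x 0))) * Literature.Probability.LatticeModels.freeExpect 3 (Literature.Probability.LatticeModels.criticalBeta 3) 0 (Literature.Probability.LatticeModels.spinPair (x + Pi.single i 1) (Function.update (x + Pi.single i 1) (0 :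 Fin 3) (2 * (n : ℤ) - (x + Pi.single i 1 : Literature.Probability.LatticeModels.Site 3) 0))) else 0) + (if x - Pi.single i 1 ∈ Literature.Probability.LatticeModels.box 3 n then (Literature.Probability.LatticeModels.twoPointFree 3 (Literature.Probability.LatticeModels.criticalBeta 3) x - Literature.Probability.LatticeModels.twoPointFree 3 (Literature.Probability.LatticeModels.criticalBeta 3) (Function.update x (0 : Fin 3) (2 * (n : ℤ) - x 0))) * Literature.Probability.LatticeModels.freeExpect 3 (Literature.Probability.LatticeModels.criticalBeta 3) 0 (Literature.Probability.LatticeModels.spinPair (x - Pi.single i 1) (Function.update (x - Pi.single i 1) (0 : Fin 3) (2 * (n : ℤ) - (x - Pi.single i 1 : Literature.Probability.LatticeModels.Site 3) 0))) else 0)))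

-- `CoerciveReflectedGradient` holds: proved by `Summit.CriticalPhenomena.Ising3DConformalLimit.Theorems.coerciveReflectedGradient_proof` @ 484cbd02805f (its module imports this route file, so no `_holds` link can be stated here).

-- earlier WindowOfGrowth (stmt-CriticalPhenomena-17621, replaced 2026-08-17T02:23:22Z -> stmt-CriticalPhenomena-18198): retired by None — (∃ κ' c₀ : ℝ, 0 < κ' ∧ 0 < c₀ ∧ ∃ N₀ : ℕ, ∀ n : ℕ, N₀ ≤ n → c₀ * (n : ℝ) ^ κ' ≤ ∑ x ∈ Literature.Probability.LatticeModels.box 3 n, ∑ i : Fin 3, ((if x + Pi.single i 1 ∈ Literature.Probability.LatticeModels.box 3 n then (Literature.Probability.LatticeModels.twoPoi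
/-- item stmt-CriticalPhenomena-18198 · crux · rank 4 · closed · proved by Summit.CriticalPhenomena.Ising3DConformalLimit.Theorems.windowOfGrowth_proof @ 3971caa22676 (prover) · by planner
why it might fail: provable now in substance (adapt dcp_isingEta_le_half_of_axis_lower and axis_lower_of_reflectedGradient; rpow bookkeeping); fails only if the two-sided bounds are dropped — a log-sense η does not give the uniform window between close scales.
sources: arXiv:2404.05700, Literature.Probability.LatticeModels.dcp_isingEta_le_half, arXiv:1912.07973
[crux] a reflected gradient growing like n^κ' (same written-out reflection as in
CoerciveReflectedGradient) plus two-sided power bounds with one exponent η force η ≤ 1/2 − κ'/2 <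
1/2 (Theorem 1.3/1.5 of DC–Panis rerun with the extra n^κ'), hence the WINDOW c(n/m)^(−(3/2−ε)) G(m
e₁) ≤ G(n e₁) for all 1 ≤ m ≤ n (ε = 1/2 − η; conclusion = item stmt-5507 WindowBelowHalf of
LatticeSDPCertificates verbatim). [deps: CoerciveReflectedGradient] [difficulty: M] -/
@[route_item "route-CriticalPhenomena-CoerciveSharpness", crux]
def WindowOfGrowth : Prop :=
  (∃ κ' c₀ : ℝ, 0 < κ' ∧ 0 < c₀ ∧ ∃ N₀ : ℕ, ∀ n : ℕ, N₀ ≤ n → c₀ * (n : ℝ) ^ κ' ≤ ∑ x ∈ Literature.Probability.LatticeModels.box 3 n, ∑ i : Fin 3, ((if x + Pi.single i 1 ∈ Literature.Probability.LatticeModels.box 3 n then (Literature.Probability.LatticeModels.twoPointFree 3 (Literature.Probability.LatticeModels.criticalBeta 3) x - Literature.Probability.LatticeModels.twoPointFree 3 (Literature.Probability.LatticeModels.criticalBeta 3) (Function.update x (0 : Fin 3) (2 * (n : ℤ) - x 0))) * Literature.Probability.LatticeModels.freeExpect 3 (Literature.Probability.LatticeModels.criticalBeta 3) 0 (Literature.Probability.LatticeModels.spinPair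 (x + Pi.single i 1) (Function.update (x + Pi.single i 1) (0 : Fin 3) (2 * (n : ℤ) - (x + Pi.single i 1 : Literature.Probability.LatticeModels.Site 3) 0))) else 0) + (if x - Pi.single i 1 ∈ Literature.Probability.LatticeModels.box 3 n then (Literature.Probability.LatticeModels.twoPointFree 3 (Literature.Probability.LatticeModels.criticalBeta 3) x - Literature.Probability.LatticeModels.twoPointFree 3 (Literature.Probability.LatticeModels.criticalBeta 3) (Function.update x (0 : Fin 3) (2 * (n : ℤ) - x 0))) * Literature.Probability.LatticeModels.freeExpect 3 (Literature.Probability.LatticeModels.criticalBeta 3) 0 (Literature.Probability.LatticeModels.spinPair (x - Pi.single i 1) (Function.update (x - Pi.single i 1) (0 : Fin 3) (2 * (n : ℤ) - (x - Pi.single i 1 : Literature.Probability.LatticeModels.Site 3) 0))) else 0))) → (∃ η : ℝ, Literature.Probability.LatticeModels.HasIsingEtaBounds 3 η) → ∃ ε c : ℝ, 0 < ε ∧ 0 < c ∧ ∀ m n : ℕ, 1 ≤ m → m ≤ n → c * ((n : ℝ) / m) ^ (-((3:ℝ) / 2 - ε)) * Literature.Probability.LatticeModels.criticalTwoPoint 3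 (Pi.single 0 (m : ℤ)) ≤ Literature.Probability.LatticeModels.criticalTwoPoint 3 (Pi.single 0 (n : ℤ))

-- `WindowOfGrowth` holds: proved by `Summit.CriticalPhenomena.Ising3DConformalLimit.Theorems.windowOfGrowth_proof` @ 3971caa22676 (its module imports this route file, so no `_holds` link can be stated here).

/-- item stmt-CriticalPhenomena-5505 · crux · rank 5 · open · by planner
why it might fail: single sourced current clusters may be thinner than double-current clusters (the second moment needs a two-point bound on P[u,v ∈ C] of chain type, ADC21 Prop. A.3 shape); the window controls G only along the axis (MMS extends it).
sources: Aizenman1982, arXiv:1912.07973, arXiv:2404.05700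
[crux] [consumer, mechanism of card top-heavy-bubble-nontriviality] If WINDOW holds for G =
criticalTwoPoint 3 along e₁ (∃ ε, c > 0, ∀ 1 ≤ m ≤ n, c (n/m)^(−(3/2−ε)) G(m e₁) ≤ G(n e₁)), then
every non-degenerate pointwise scaling limit (ρ > 0 on (0,1], S) of criticalCorr 3 has U₄ ≢ 0 — the
conclusion is item stmt-CriticalPhenomena-0636 verbatim. Intended proof: WINDOW ⇒ all-scale doubling
+ top-heavy bubble Σ_{‖w‖≤R} G² ≤ C R³ G(Re₁)² (support items below); second moment on the number of
common points of two independent sourced critical currents, switching lemma and a sourced tree bound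
give P[merge] ≥ c′ R³G(R)²/Σ_{‖w‖≤R}G² ≥ c″ > 0 at all macroscopic 4-tuples; Aizenman's identity U₄
= −2⟨σσ⟩⟨σσ⟩·P[merge] and the renormalisation-free ratio U₄/(S₂S₂) pass to any non-degenerate limit.
[difficulty: XL] -/
@[route_item "route-CriticalPhenomena-CoerciveSharpness", crux]
def WindowForcesU4 : Prop :=
  (∃ ε c : ℝ, 0 < ε ∧ 0 < c ∧ ∀ m n : ℕ, 1 ≤ m → m ≤ n → c * ((n : ℝ) / m) ^ (-((3:ℝ) / 2 - ε)) * Literature.Probability.LatticeModels.criticalTwoPoint 3 (Pi.single 0 (m : ℤ)) ≤ Literature.Probability.LatticeModels.criticalTwoPoint 3 (Pi.single 0 (n : ℤ))) → ∀ (ρ : ℝ → ℝ) (S : Literature.Probability.LatticeModels.CorrFamily 3), (∀ δ ∈ Set.Ioc (0:ℝ) 1, 0 < ρ δ) → Literature.Probability.LatticeModels.HasPointwiseScalingLimit (Literature.Probability.LatticeModels.criticalCorr 3) ρ S → Literature.Probability.LatticeModels.IsNondegenerateTwoPoint S → Literature.Probability.LatticeModels.HasNontrivialU4 S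

/-- item stmt-CriticalPhenomena-4662 · crux · rank 6 · open · by planner
why it might fail: existence of η in this strong form is open on ℤ³ (ICM 2022 §8.4); only c‖x‖⁻² ≤ G ≤ C‖x‖⁻¹ is known, and a slowly varying correction would falsify the two-sided form while keeping a log-sense η.
sources: DuminilCopinICM2022, arXiv:1912.07973, arXiv:2404.05700
[support] two-sided pure-power bounds c‖x‖^{-(1+η)} ≤ ⟨σ₀σ_x⟩_{β_c(3)} ≤ C‖x‖^{-(1+η)} for some η
(HasIsingEtaBounds 3 η). Lattice partial engine for ClusterSetTotallyDisconnected: under it every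
scale-covariant cluster point has exponent exactly Δ = (1+η)/2 (λ^{-2(Δ_S−Δ)} ∈ [c/C, C/c] for all λ
> 0 forces Δ_S = Δ), so 𝒞 can only wander at FIXED two-point function. The log-sense exponent of
item 0635 (HasIsingExponentEta) does NOT suffice: g(n) = n^{-2a}·exp(c·√(log n)·sin √(log n)) has η
= 2a−1 yet a whole interval of pure-power cluster exponents. = output (D2) of card
every-scale-regular-multiplicative-fekete; 'under the power-law assumption every scale is regular …
no unconditional proof' (ADC21 §5.6). [difficulty: open-problem] -/
@[route_item "route-CriticalPhenomena-CoerciveSharpness", crux]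
def DimensionPinned : Prop :=
  ∃ η : ℝ, Literature.Probability.LatticeModels.HasIsingEtaBounds 3 η

/-- item stmt-CriticalPhenomena-1344 · crux · rank 7 · SPLIT (gen 1) into ExistsScaleCovariantLimit, InversionUpgradeNormalised + glue MoebiusLimitOfSubs · direct attempts still welcome (low priority) · by planner
why it might fail: existence (stmt-1981) and inversion covariance (stmt-1982) are open on ℤ³; ScaleCovarianceNotMoebius shows Euclidean + scale data never force inversion.
sources: DuminilCopinICM2022, PolandRychkovVichi2019, Literature.Barriers.CriticalPhenomena.ScaleCovarianceNotMoebius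
[crux] r5 = MoebLim (IMPORTED COMPLEMENT, lowest rank): the critical Ising correlators on ℤ³ have a
non-degenerate pointwise scaling limit (ρ > 0 on (0,1], Δ > 0, S) that is Möbius covariant with
dimension Δ — the conjunct Ising3DConformalLimit minus clause (iii). Written verbatim as the
conjunct's definiens without '∧ HasNontrivialU4 S' so that other routes filing the same complement
attach here. This route does not attack existence, rotation or inversion covariance; it bets on the
covariance lines (IsingEuclidUpgrade r5/r6 = items 0637/0638, IsingCFTData r2 = 0665, cards
hyperoctahedral-rp-rigidity / inversion-first-moebius-from-translations). S may be taken 0 off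
NonCoincident, so no coincident-configuration junk obstructs the existential. -/
@[route_item "route-CriticalPhenomena-CoerciveSharpness", crux]
def MoebiusLimit : Prop :=
  ∃ (ρ : ℝ → ℝ) (Δ : ℝ) (S : Literature.Probability.LatticeModels.CorrFamily 3), (∀ δ ∈ Set.Ioc (0:ℝ) 1, 0 < ρ δ) ∧ 0 < Δ ∧ Literature.Probability.LatticeModels.HasPointwiseScalingLimit (Literature.Probability.LatticeModels.criticalCorr 3) ρ S ∧ Literature.Probability.LatticeModels.IsNondegenerateTwoPoint S ∧ Literature.Probability.LatticeModels.IsMoebiusCovariant Δ S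

-- parent: MoebiusLimit · child (gen 1)
/--     item stmt-CriticalPhenomena-1981 · crux · rank 701 · open
    parent: MoebiusLimit · by planner
    why it might fail: Existence of the full δ→0⁺ limit of all n-point functions with one continuous Δ > 0 is the open problem on ℤ³ (ICM2022 §8.4 p.29, 'widely open'): c|x|⁻² ≤ G ≤ C|x|⁻¹ (ADS2015, DC–Panis) gives only subsequential limits, Δ ∈ [1/2,1]; no uniqueness / exact scale-covariance mechanism known in d = 3.
    sources: DuminilCopinICM2022, DuminilcopinPanis2025, AizenmanDuminilCopinSidoravicius2015, AizenmanDuminilCopinAnnals2021, Literature.Probability.LatticeModels.PointwiseScalingLimitDiscreteScaleInvariance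
[crux r4, (C), existence WITHOUT rotations] There are ρ > 0 on (0,1], Δ > 0 and S with
HasPointwiseScalingLimit (criticalCorr 3) ρ S, S = 0 off NonCoincident, IsNondegenerateTwoPoint S,
IsTranslationInvariant S, IsScaleCovariant Δ S. Strictly weaker than CritIsing3DEuclideanLimit (item
0638: rotations included) — on this route isotropy is OUTPUT. Inputs in tree:
criticalTwoPoint_bounds_holds (c|x|⁻² ≤ G ≤ C|x|⁻¹ ⇒ subsequential limits, Δ ∈ [1/2,1]); missing:
uniqueness/full-filter convergence and continuous scale covariance (DuminilCopinICM2022 §8.4 p.29: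
'widely open'). -/
@[route_item "route-CriticalPhenomena-CoerciveSharpness", crux]
def ExistsScaleCovariantLimit : Prop :=
  ∃ (ρ : ℝ → ℝ) (Δ : ℝ) (S : Literature.Probability.LatticeModels.CorrFamily 3), (∀ δ ∈ Set.Ioc (0:ℝ) 1, 0 < ρ δ) ∧ 0 < Δ ∧ Literature.Probability.LatticeModels.HasPointwiseScalingLimit (Literature.Probability.LatticeModels.criticalCorr 3) ρ S ∧ (∀ n z, z ∉ Literature.Probability.LatticeModels.NonCoincident 3 n → S n z = 0) ∧ Literature.Probability.LatticeModels.IsNondegenerateTwoPoint S ∧ Literature.Probability.LatticeModels.IsTranslationInvariant S ∧ Literature.Probability.LatticeModels.IsScaleCovariant Δ S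

-- parent: MoebiusLimit · child (gen 1)
/--     item stmt-CriticalPhenomena-1982 · crux · rank 702 · open
    parent: MoebiusLimit · by planner
    why it might fail: Scale + Euclid (+ RP) ⇏ inversion covariance in general (free Maxwell d = 3, ElshowkNakayamaRychkov2011; witnessFamily of ScaleCovarianceNotMoebius); for Ising it rests on absence of a Δ = 2 virial current, backed only by non-rigorous RG (DTW2016 §5–6) and Monte-Carlo Δ_V > 5 (MenesesEtAl2019).
    sources: ElshowkNakayamaRychkov2011, Nakayama2015, DelamotteTissierWschebor2016, MenesesEtAl2019, PolandRychkovVichi2019, Literature.Barriers.CriticalPhenomena.ScaleCovarianceNotMoebius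
[crux r5, (D), inversion upgrade re-typed] Every pointwise scaling limit S of criticalCorr 3 (ρ > 0
on (0,1]) that is normalised (S = 0 off NonCoincident), non-degenerate, Euclidean invariant and
scale covariant with Δ is IsInversionCovariant Δ (hence Möbius). This is (U) of route
IsingEuclidUpgrade (item 0637, refuted AS TYPED by not_inversionUpgrade_of_euclideanLimit through
values on the coincident locus) with the normalisation hypothesis the refutation file prescribes;
the model-blind version is false (Literature.Barriers.CriticalPhenomena.ScaleCovarianceNotMoebius;
free Maxwell d=3, ElshowkNakayamaRychkov2011), so any proof must use the Ising hypothesis (RP +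
locality / absence of a dimension-2 virial current: DelamotteTissierWschebor2016 §5–6,
Nakayama2015). -/
@[route_item "route-CriticalPhenomena-CoerciveSharpness", crux]
def InversionUpgradeNormalised : Prop :=
  ∀ (ρ : ℝ → ℝ) (Δ : ℝ) (S : Literature.Probability.LatticeModels.CorrFamily 3), (∀ δ ∈ Set.Ioc (0:ℝ) 1, 0 < ρ δ) → Literature.Probability.LatticeModels.HasPointwiseScalingLimit (Literature.Probability.LatticeModels.criticalCorr 3) ρ S → (∀ n z, z ∉ Literature.Probability.LatticeModels.NonCoincident 3 n → S n z = 0) → Literature.Probability.LatticeModels.IsNondegenerateTwoPoint S → Literature.Probability.LatticeModels.IsEuclideanInvariant S → Literature.Probability.LatticeModels.IsScaleCovariant Δ S → Literature.Probability.LatticeModels.IsInversionCovariant Δ S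

-- parent: MoebiusLimit · glue (gen 1)
/--     item stmt-CriticalPhenomena-19104 · support · rank 703 · closed · proved by Summit.CriticalPhenomena.Ising3DConformalLimit.CoerciveSharpnessMoebiusLimitOfSubs.moebiusLimitOfSubs @ 2a2cead3f2b5 (operator)
    parent: MoebiusLimit · GLUE: children ⟹ parent · by operator
GLUE of the three-leaf split of MoebiusLimit (item stmt-CriticalPhenomena-1344) on route
CoerciveSharpness, filed by the crux-strategist before any lead is seated on this route:
TwoPointDoubling → ClusterSetTotallyDisconnected → InversionUpgradeNormalised → MoebiusLimit.
PROVABLE NOW, kernel-checked in the item evidence `SplitGlue.lean` on stmt-1344 (lean check rc 0, 0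
sorry, std axioms; intended tree file Theorems/CoerciveSharpnessMoebiusLimitSplit.lean, prover-only
to land): `fun h6150 h4659 h1982 =>
Summit.CriticalPhenomena.Ising3DConformalLimit.MoebiusLimitExistsTwoLeaf.coerciveSharpness_MoebiusLimit_of_leaves
(Summit.CriticalPhenomena.Ising3DConformalLimit.Cruxes.ExistsScaleCovariantLimit.FoldedCurrentRepulsion.crux_iff_doubling_and_totallyDisconnected.mpr
⟨h6150, h4659⟩) h1982` (imports Theorems/PlantedPinningMoebiusLimitExistsTwoLeaf p142965 +
Theorems/HyperoctahedralRPExistsScaleCovariantLimitFoldedCurrentUniqueness p139907; the children are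
items 6150/4659/1982 verbatim, so the MirrorHoelderCompactness / ClusterRigidity / HyperoctahedralRP
spellings unify by `exact`). Converse (each leaf necessary): MoebiusLimit_iff_subs. On this route
the first leaf is discharged by the r -/
@[route_item "route-CriticalPhenomena-CoerciveSharpness"]
def MoebiusLimitOfSubs : Prop :=
  ExistsScaleCovariantLimit → InversionUpgradeNormalised → MoebiusLimit

-- `MoebiusLimitOfSubs` holds: proved by `Summit.CriticalPhenomena.Ising3DConformalLimit.CoerciveSharpnessMoebiusLimitOfSubs.moebiusLimitOfSubs` @ 2a2cead3f2b5 (its module imports this route file, so no `_holds` link can be stated here).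

/-- item stmt-CriticalPhenomena-17622 · assembly · rank 1 · open · by planner
sources: arXiv:2404.05700, Aizenman1982
[assembly] PhiCoercive → CoerciveReflectedGradient → WindowOfGrowth → DimensionPinned →
WindowForcesU4 → MoebiusLimit → the conjunct. -/
@[route_item "route-CriticalPhenomena-CoerciveSharpness"]
def Assembly : Prop :=
  PhiCoercive → CoerciveReflectedGradient → WindowOfGrowth → DimensionPinned → WindowForcesU4 → MoebiusLimit → _root_.Ising3DConformalLimit

/-! D-0027 §2.1 — DECIDING THEOREM (planner-authored via `route open/edit --closes-file`; by planner-rrepair-CriticalPhenomena-CoerciveShar-65dfe21b-0 2026-08-17T02:23:22Z):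
its hypotheses are this route's items and its conclusion the sub-problem Statement (glue_lint), and it elaborates with this file. -/

@[closes "route-CriticalPhenomena-CoerciveSharpness"] theorem closes (h₁ : PhiCoercive) (h₂ : CoerciveReflectedGradient) (h₃ : WindowOfGrowth)
    (h₄ : DimensionPinned) (h₅ : WindowForcesU4) (h₆ : MoebiusLimit) :
    _root_.Ising3DConformalLimit := by
  obtain ⟨ρ, Δ, S, hρ, hΔ, hlim, hnd, hM⟩ := h₆
  exact ⟨ρ, Δ, S, hρ, hΔ, hlim, hnd, hM, h₅ (h₃ (h₂ h₁) h₄) ρ S hρ hlim hnd⟩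

end Summit.CriticalPhenomena.Ising3DConformalLimit.Theses.CoerciveSharpness
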